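import Mathlib
import HarnessLib
import Literature.MathematicalPhysics.KineticTheory.HardSphereEuler
import Literature.MathematicalPhysics.KineticTheory.BackwardCluster
import Summits.AtomisticToContinuum.HydrodynamicLimit.Theses.RelayRaceLocality

/-!
# Crux `RelayRaceLocality.GibbsLightCone` (stmt-AtomisticToContinuum-12501) — crux-strategist sketch for the
idea card `multi-needle-polymer-induction` (Lens: strengthen-to-induct, D2 sector)

Typed objects only (no proof obligations of the crux are claimed):

* `SeparatedForestFlightDamping` — the STRENGTHENED induction hypothesis S⁺ of the card: forests of
  `m ≤ K log(N+2)` prescribed distinct hot spheres, each collision-free on `[0, T_i]`, whose straight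
  flight segments stay `2 ε_N` apart (no drafting), have total free path `> y ℓ_N` with probability
  `≤ C^m e^{-η y}`, `1 ≤ y ≤ K log(N+2)`, constants fixed before `σ`.
* `hotFlightDampingBC_of_forest` — its `m = 1` slice is `IdeatorFour.HotFlightDampingBC` (D2) verbatim
  (PROVED below: the single-needle target drops out of the forest statement).
-/

namespace Summit.AtomisticToContinuum.HydrodynamicLimit.Cruxes.GibbsLightCone.MultiNeedle

open Literature.Analysis.FluidPDE Literature.MathematicalPhysics.KineticTheory MeasureTheory Filter Set
open scoped ENNReal BigOperators

/-- Kinetic length unit `ℓ_N = (N+1)^{-1/3} / σ²` (verbatim `IdeatorFour.ell`, `Seams.lean`). -/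
noncomputable def ell (σ : ℝ) (N : ℕ) : ℝ := (((N + 1 : ℕ) : ℝ) ^ (-(1 / 3 : ℝ))) / σ ^ 2

/-- D2 = `IdeatorFour.HotFlightDampingBC` VERBATIM (restated here so this sketch does not import a crux
workfile): a tagged sphere faster than `A√θ` flies collision-free over a path of `y ℓ_N` with
probability `≤ C e^{-η y}`, `1 ≤ y ≤ K log(N+2)`, eventually in `N`, constants before `σ`. -/
def HotFlightDampingBC : Prop :=
  ∀ a θ : ℝ, 0 < a → 0 < θ → ∃ σ₀ : ℝ, 0 < σ₀ ∧ ∃ A η C : ℝ, 0 < A ∧ 0 < η ∧ 0 < C ∧ ∀ K : ℝ, 0 < K →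
    ∀ σ : ℝ, 0 < σ → σ < σ₀ →
    ∀ Φ : (N : ℕ) → HardSphereFlow (Torus.geometry (Fin 3)) (hsDiameter σ N) (N + 1),
    ∀ᶠ N : ℕ in atTop, ∀ y : ℝ, 1 ≤ y → y ≤ K * Real.log ((N : ℝ) + 2) → ∀ T : ℝ, 0 < T →
      localGibbsLaw σ (fun _ => a) (fun _ => 0) (fun _ => θ) N (Φ N)
          {z | (Φ N).backwardCluster 0 0 T z = ∅ ∧ A * Real.sqrt θ < ‖(z 0).2‖ ∧
               y * ell σ N < ‖(z 0).2‖ * T}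
        ≤ ENNReal.ofReal (C * Real.exp (-η * y))

/-- S⁺ (strengthen-to-induct): SEPARATED-FOREST FLIGHT DAMPING. For `m` prescribed distinct spheres
`q i`, each faster than `A√θ` at time `0` and collision-free on `[0, T_i]` (empty APST backward cluster
over `(0, T_i]`), whose flight positions stay pairwise `≥ 2ε_N` apart at all pairs of times (no two
needles share a corridor — the drafting counterexample of STRATEGY-CENSUS §Negation (N-d) is excluded),
the total free path `Σ_i ‖v_{q i}‖ T_i` exceeds `y ℓ_N` with probability `≤ C^m e^{-η y}`, for
`1 ≤ y ≤ K log(N+2)`, `m ≤ K log(N+2)`, eventually in `N`, constants before `σ`. -/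
def SeparatedForestFlightDamping : Prop :=
  ∀ a θ : ℝ, 0 < a → 0 < θ → ∃ σ₀ : ℝ, 0 < σ₀ ∧ ∃ A η C : ℝ, 0 < A ∧ 0 < η ∧ 0 < C ∧ ∀ K : ℝ, 0 < K →
    ∀ σ : ℝ, 0 < σ → σ < σ₀ →
    ∀ Φ : (N : ℕ) → HardSphereFlow (Torus.geometry (Fin 3)) (hsDiameter σ N) (N + 1),
    ∀ᶠ N : ℕ in atTop, ∀ (m : ℕ) (q : Fin m → Fin (N + 1)) (Tq : Fin m → ℝ),
      Function.Injective q → (m : ℝ) ≤ K * Real.log ((N : ℝ) + 2) → (∀ i, 0 < Tq i) →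
      ∀ y : ℝ, 1 ≤ y → y ≤ K * Real.log ((N : ℝ) + 2) →
      localGibbsLaw σ (fun _ => a) (fun _ => 0) (fun _ => θ) N (Φ N)
          {z | (∀ i, (Φ N).backwardCluster (q i) 0 (Tq i) z = ∅ ∧ A * Real.sqrt θ < ‖(z (q i)).2‖) ∧
               (∀ i j, i ≠ j → ∀ t ∈ Set.Icc 0 (Tq i), ∀ t' ∈ Set.Icc 0 (Tq j),
                  2 * hsDiameter σ N ≤
                    Torus.euclidDist (((Φ N).flow t z) (q i)).1 (((Φ N).flow t' z) (q j)).1) ∧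
               y * ell σ N < ∑ i, ‖(z (q i)).2‖ * Tq i}
        ≤ ENNReal.ofReal (C ^ m * Real.exp (-η * y))

/-- The single-needle target D2 (`HotFlightDampingBC`) is the `m = 1` slice of S⁺. -/
theorem hotFlightDampingBC_of_forest : SeparatedForestFlightDamping → HotFlightDampingBC := by
  intro h a θ ha hθ
  obtain ⟨σ₀, hσ₀, A, η, C, hA, hη, hC, H⟩ := h a θ ha hθ
  refine ⟨σ₀, hσ₀, A, η, C, hA, hη, hC, fun K hK σ hσ hσσ₀ Φ => ?_⟩
  filter_upwards [H K hK σ hσ hσσ₀ Φ, eventually_ge_atTop 1] with N hN hN1 y hy hyK T hT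
  have hlog : (1 : ℝ) ≤ K * Real.log ((N : ℝ) + 2) := le_trans hy hyK
  have key := hN 1 (fun _ => 0) (fun _ => T) (fun i j _ => Subsingleton.elim i j)
    (by simpa using hlog) (fun _ => hT) y hy hyK
  refine le_trans (measure_mono ?_) (le_trans key (le_of_eq (by simp)))
  intro z hz
  simp only [Set.mem_setOf_eq] at hz ⊢
  obtain ⟨hbc, hAv, hy'⟩ := hz
  refine ⟨fun _ => ⟨hbc, hAv⟩, ?_, ?_⟩
  · intro i j hij
    exact absurd (Subsingleton.elim i j) hij
  · simpa using hy'

end Summit.AtomisticToContinuum.HydrodynamicLimit.Cruxes.GibbsLightCone.MultiNeedle
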